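import Literature.Analysis.FluidPDE.TorusClassicalNSH2Smoothing
import Literature.Analysis.FluidPDE.TorusClassicalNSTimeDerivative
import Literature.Analysis.FluidPDE.StatisticalSolutionEnergyEq
import Literature.Analysis.FunctionSpaces.TorusClassicalNSGluing
import Summits.AnomalousDissipation.AnomalousDissipation.Theorems.BaireTransferDenseLoudDesignerForcesStubTrajectoryPowerBudget

/-!
# Uniform `H²` bounds along an NS phase after a time lapse (block N1 of stub `stub_smoothModel`,
# line `ergodic-budget-selection-closing`, crux `BaireTransfer.DenseLoudDesignerForces`, stmt-AnomalousDissipation-1143)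

Summit-side corollary of the Literature smoothing estimate
`Torus.IsClassicalNSSolutionOn.integral_norm_laplacian_sq_le_of_gradNormSq_le`
(`Literature/Analysis/FluidPDE/TorusClassicalNSH2Smoothing.lean`) for the line vocabulary
`IsNSPhase` (`…ErgodicLine.lean`): along an NS phase `(K, φ)` of a steady force `F` at viscosity `ν > 0`,

* `IsNSPhase.hasZeroMean_of_rep_ae_eq` — the smooth representative `u(t)` of a state `φ_t x ∈ H` has zero mean;
* `IsNSPhase.exists_forall_gradNormSq_le` — the enstrophy `‖∇u(t)‖₂²` of every trajectory is bounded, uniformly on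
  `K × [0, ∞)` (the enstrophy observable is continuous on the compact forward-invariant `K`);
* `IsNSPhase.exists_forall_integral_norm_laplacian_sq_le` — **for every `τ > 0` there is `C` with
  `∫ ‖Δu(t)‖² ≤ C` for every `x ∈ K`, every classical trajectory `(u, p)` of `x` and every `t ≥ τ`**: the sets
  `φ_t(K)`, `t ≥ τ`, in particular `K_∞ = ⋂ₙ φₙ(K)`, are bounded in `H²` — the first step (N1, `m = 2`) of the
  smooth-model construction of the registered stub `stub_smoothModel`;
* `IsNSPhase.exists_forall_norm_le` — hence a uniform sup-norm bound `‖u(t, y)‖ ≤ M` for `t ≥ τ` (the coefficient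
  bound of the `H → V` smoothing estimates `Literature/Analysis/FluidPDE/TorusLinearisedNSSmoothing.lean`,
  `Literature/Analysis/FunctionSpaces/TorusClassicalNSDifferenceSmoothing.lean`);
* `IsNSPhase.exists_forall_integral_norm_timeDerivWithin_sq_le` — and a uniform `L²` speed bound `∫ ‖∂ₜu(t)‖² ≤ W`
  for `t ≥ τ` (`Literature/Analysis/FluidPDE/TorusClassicalNSTimeDerivative.lean`).

References: Robinson–Rodrigo–Sadowski, *The Three-Dimensional Navier–Stokes Equations* (CUP 2016) Thm 7.1, 7.3;
Constantin–Foias, *Navier–Stokes Equations* (1988) Thm 10.6.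
-/

-- `Summit.<Summit>.<Problem>` is the tree's mandated summit-side namespace (CONVENTIONS §2); for this
-- single-conjunct summit the two coincide, so the duplicate is deliberate.
set_option linter.dupNamespace false

noncomputable section

open scoped BigOperators Topology ENNReal InnerProductSpace
open Filter Set Function MeasureTheory

namespace Summit.AnomalousDissipation.AnomalousDissipation.Theorems.DenseLoudDesignerForces.Ergodic

open Literature.Analysis.FunctionSpaces Literature.Analysis.FunctionSpaces.Torus
open Literature.Analysis.FluidPDE Literature.Analysis.FluidPDE.Torus
open Summit.AnomalousDissipation.AnomalousDissipation.Theses.BaireTransfer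
open Summit.AnomalousDissipation.AnomalousDissipation.Theorems.DenseLoudDesignerForces.Negative

variable {ν : ℝ} {F : (UnitAddTorus (Fin 3)) → (EuclideanSpace ℝ (Fin 3))} {K : Set Hsp} {φ : ℝ → Hsp → Hsp}

/-- A smooth field representing a state of `H` has zero mean (states of `H` are mean-zero classes,
`Torus.integral_eq_zero_of_mem_energySpace`, and the integral only sees the a.e.-class). [folklore] -/
theorem hasZeroMean_of_rep_ae_eq (v : Hsp) {w : (UnitAddTorus (Fin 3)) → (EuclideanSpace ℝ (Fin 3))} (h : rep v =ᵐ[volume] w) : HasZeroMean w := by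
  unfold HasZeroMean
  rw [← integral_eq_zero_of_mem_energySpace v.2]
  exact integral_congr_ae h.symm

/-- **Uniform enstrophy bound along an NS phase.** There is `E₁` such that for every `x ∈ K`, every classical
trajectory `(u, p)` of `x` and every `t ≥ 0`, `‖∇u(t)‖₂² ≤ E₁`: the enstrophy observable is continuous on the
compact `K` (`IsNSPhase.enstrophy_continuousOn`, `IsCompact.bddAbove_image`), `K` is forward invariant, and
`enstrophyObs (φ_t x) = ‖∇u(t)‖₂²` for the smooth representative (`stub_trajectoryPowerBudget_aux_enstrophyObs_eq`).
[folklore] -/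
theorem IsNSPhase.exists_forall_gradNormSq_le (hK : IsNSPhase ν F K φ) :
    ∃ E₁ : ℝ, ∀ x ∈ K, ∀ (u : ℝ → (UnitAddTorus (Fin 3)) → (EuclideanSpace ℝ (Fin 3))) (p : ℝ → (UnitAddTorus (Fin 3)) → ℝ),
      IsClassicalNSSolutionOn (Ici 0) ν (fun _ => F) u p → (∀ t : ℝ, 0 ≤ t → rep (φ t x) =ᵐ[volume] u t) →
      ∀ t : ℝ, 0 ≤ t → gradNormSq (u t) ≤ E₁ := by
  obtain ⟨E₁, hE₁⟩ := hK.isCompact.bddAbove_image hK.enstrophy_continuousOn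
  refine ⟨E₁, fun x hx u p hsol hrep t ht => ?_⟩
  have hmem : φ t x ∈ K := hK.mapsTo t ht hx
  have hsm : IsSmooth (u t) := hsol.smooth_velocity.isSmooth_slice (mem_Ici.2 ht)
  rw [← stub_trajectoryPowerBudget_aux_enstrophyObs_eq (φ t x) hsm (hrep t ht)]
  exact hE₁ (mem_image_of_mem _ hmem)

/-- **Uniform `H²` bound along an NS phase after a time lapse** (parabolic smoothing, Robinson–Rodrigo–Sadowski
2016 Thm 7.1/7.3 in the quantitative form `Torus.IsClassicalNSSolutionOn.integral_norm_laplacian_sq_le_of_gradNormSq_le`):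
for an NS phase `(K, φ)` of the steady force `F` at viscosity `ν > 0` and every `τ > 0` there is `C` such that
for every `x ∈ K`, every classical trajectory `(u, p)` of `x` and every `t ≥ τ`, `∫ ‖Δu(t)‖² ≤ C`.  Proof: restrict
the trajectory to `[t − τ, t]` (`Torus.IsClassicalNSSolutionOn.mono`), where the slices have zero mean
(`hasZeroMean_of_rep_ae_eq`), enstrophy `≤ E₁` (`exists_forall_gradNormSq_le`) and the force has the constant
gradient norm `‖∇F‖₂²`. [cite: RobinsonRodrigoSadowskiCUP2016, Thm 7.1 and Thm 7.3] -/
theorem IsNSPhase.exists_forall_integral_norm_laplacian_sq_le (hν : 0 < ν) (hK : IsNSPhase ν F K φ)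
    {τ : ℝ} (hτ : 0 < τ) :
    ∃ C : ℝ, ∀ x ∈ K, ∀ (u : ℝ → (UnitAddTorus (Fin 3)) → (EuclideanSpace ℝ (Fin 3))) (p : ℝ → (UnitAddTorus (Fin 3)) → ℝ),
      IsClassicalNSSolutionOn (Ici 0) ν (fun _ => F) u p → (∀ t : ℝ, 0 ≤ t → rep (φ t x) =ᵐ[volume] u t) →
      ∀ t : ℝ, τ ≤ t → ∫ y, ‖laplacian (u t) y‖ ^ 2 ≤ C := by
  obtain ⟨E₁, hE₁⟩ := hK.exists_forall_gradNormSq_le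
  obtain ⟨C, hC⟩ := IsClassicalNSSolutionOn.integral_norm_laplacian_sq_le_of_gradNormSq_le
    (d := Fin 3) (Fintype.card_fin 3) hν E₁ (gradNormSq F) hτ
  refine ⟨C, fun x hx u p hsol hrep t ht => ?_⟩
  have ht0 : 0 ≤ t - τ := sub_nonneg.2 ht
  have hsub : Icc (t - τ) (t - τ + τ) ⊆ Ici 0 := fun s hs => mem_Ici.2 (ht0.trans hs.1)
  have hlt : t - τ < t - τ + τ := by linarith
  have hsol' : IsClassicalNSSolutionOn (Icc (t - τ) (t - τ + τ)) ν (fun _ => F) u p :=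
    hsol.mono hsub (uniqueDiffOn_Icc hlt)
  have h := hC hsol' (fun s hs => hasZeroMean_of_rep_ae_eq (φ s x) (hrep s (hsub hs)))
    (fun s hs => hE₁ x hx u p hsol hrep s (hsub hs)) (fun s _ => le_rfl)
  rwa [sub_add_cancel] at h

/-- **Uniform sup-norm bound along an NS phase after a time lapse**: for every `τ > 0` there is `M` with
`‖u(t, y)‖ ≤ M` for every `x ∈ K`, every classical trajectory `(u, p)` of `x`, every `t ≥ τ` and every
`y ∈ T³` — the sup-norm embedding `‖u(y)‖² ≤ K₀ (‖∇u‖₂² + ‖Δu‖₂²)` for zero-mean fields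
(`Torus.norm_sq_le_gradNormSq_add_of_hasZeroMean`) on top of the uniform enstrophy and `H²` bounds.  This is the
coefficient bound `‖u‖ ≤ M` consumed by the `H → V` smoothing estimates of the linearised and difference equations
(`Torus.linearisedNS_sub_mul_gradNormSq_le`, `Torus.IsClassicalNSSolutionOn.sub_mul_gradNormSq_sub_le`). [folklore] -/
theorem IsNSPhase.exists_forall_norm_le (hν : 0 < ν) (hK : IsNSPhase ν F K φ) {τ : ℝ} (hτ : 0 < τ) :
    ∃ M : ℝ, ∀ x ∈ K, ∀ (u : ℝ → (UnitAddTorus (Fin 3)) → (EuclideanSpace ℝ (Fin 3))) (p : ℝ → (UnitAddTorus (Fin 3)) → ℝ),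
      IsClassicalNSSolutionOn (Ici 0) ν (fun _ => F) u p → (∀ t : ℝ, 0 ≤ t → rep (φ t x) =ᵐ[volume] u t) →
      ∀ t : ℝ, τ ≤ t → ∀ y, ‖u t y‖ ≤ M := by
  obtain ⟨E₁, hE₁⟩ := hK.exists_forall_gradNormSq_le
  obtain ⟨C, hC⟩ := hK.exists_forall_integral_norm_laplacian_sq_le hν hτ
  obtain ⟨K₀, hK₀, hsup⟩ := norm_sq_le_gradNormSq_add_of_hasZeroMean (d := Fin 3) (Fintype.card_fin 3)
  refine ⟨Real.sqrt (K₀ * (E₁ + C)), fun x hx u p hsol hrep t ht y => ?_⟩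
  have ht0 : 0 ≤ t := hτ.le.trans ht
  have hsm : IsSmooth (u t) := hsol.smooth_velocity.isSmooth_slice (mem_Ici.2 ht0)
  have h0 : HasZeroMean (u t) := hasZeroMean_of_rep_ae_eq (φ t x) (hrep t ht0)
  have h1 := hsup (u t) hsm h0 y
  have h2 := hE₁ x hx u p hsol hrep t ht0
  have h3 := hC x hx u p hsol hrep t ht
  rw [← Real.sqrt_sq (norm_nonneg (u t y))]
  exact Real.sqrt_le_sqrt (h1.trans (mul_le_mul_of_nonneg_left (add_le_add h2 h3) hK₀.le))

/-- **Uniform `L²` speed bound along an NS phase after a time lapse**: for every `τ > 0` there is `W` with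
`∫ ‖∂ₜu(t)‖² ≤ W` for every `x ∈ K`, every classical trajectory `(u, p)` of `x` and every `t ≥ τ`, where
`∂ₜu = Torus.timeDerivWithin (Ici 0) u` is the one-sided time derivative of the trajectory — the speed bound
`‖du/dt‖ ≤ ν|Au| + |f| + |B(u,u)|` (`Torus.IsClassicalNSSolutionOn.integral_norm_timeDerivWithin_sq_le_of_norm_le`)
on top of the uniform enstrophy, `H²` and sup-norm bounds; the time derivative within `[t − τ, t]` agrees with the one
within `[0, ∞)` (`Torus.IsSmoothSpaceTimeOn.timeDerivWithin_eq_of_subset`).  This is the constant `V = sup ‖∂ₜu‖₂` of the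
decoding step of the closing argument (equal-time distances along shadowing orbits). [folklore] -/
theorem IsNSPhase.exists_forall_integral_norm_timeDerivWithin_sq_le (hν : 0 < ν) (hK : IsNSPhase ν F K φ)
    {τ : ℝ} (hτ : 0 < τ) :
    ∃ W : ℝ, ∀ x ∈ K, ∀ (u : ℝ → (UnitAddTorus (Fin 3)) → (EuclideanSpace ℝ (Fin 3))) (p : ℝ → (UnitAddTorus (Fin 3)) → ℝ),
      IsClassicalNSSolutionOn (Ici 0) ν (fun _ => F) u p → (∀ t : ℝ, 0 ≤ t → rep (φ t x) =ᵐ[volume] u t) →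
      ∀ t : ℝ, τ ≤ t → ∫ y, ‖Torus.timeDerivWithin (Ici 0) u t y‖ ^ 2 ≤ W := by
  obtain ⟨E₁, hE₁⟩ := hK.exists_forall_gradNormSq_le
  obtain ⟨C, hC⟩ := hK.exists_forall_integral_norm_laplacian_sq_le hν hτ
  obtain ⟨M, hM⟩ := hK.exists_forall_norm_le hν hτ
  refine ⟨3 * (ν ^ 2 * C + (∫ y, ‖F y‖ ^ 2) + Fintype.card (Fin 3) * M ^ 2 * E₁),
    fun x hx u p hsol hrep t ht => ?_⟩
  have ht0 : 0 ≤ t - τ := sub_nonneg.2 ht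
  have hsub : Icc (t - τ) t ⊆ Ici 0 := fun s hs => mem_Ici.2 (ht0.trans hs.1)
  have hlt : t - τ < t := by linarith
  have htm : t ∈ Icc (t - τ) t := right_mem_Icc.2 hlt.le
  have hsol' : IsClassicalNSSolutionOn (Icc (t - τ) t) ν (fun _ => F) u p := hsol.mono hsub (uniqueDiffOn_Icc hlt)
  have heq : ∀ y, Torus.timeDerivWithin (Ici 0) u t y = Torus.timeDerivWithin (Icc (t - τ) t) u t y := fun y =>
    (hsol.smooth_velocity.timeDerivWithin_eq_of_subset hsub (uniqueDiffOn_Icc hlt) htm y).symm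
  have h1 := hsol'.integral_norm_timeDerivWithin_sq_le_of_norm_le hlt htm (hM x hx u p hsol hrep t ht)
  have h2 := hE₁ x hx u p hsol hrep t (hτ.le.trans ht)
  have h3 := hC x hx u p hsol hrep t ht
  have hM2 : 0 ≤ (Fintype.card (Fin 3) : ℝ) * M ^ 2 := by positivity
  simp_rw [heq]
  nlinarith [h1, mul_le_mul_of_nonneg_left h3 (sq_nonneg ν), mul_le_mul_of_nonneg_left h2 hM2]

/-- **Registered tools stub of block N1 (`stub_ergodicH2SmoothingTools`, crux stmt-AnomalousDissipation-1143, line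
`ergodic-budget-selection-closing`)**: the conjunction of the four uniform bounds along an NS phase proved above — enstrophy,
`H²` smoothing, sup-norm and speed bounds on `φ_t(K)`, `t ≥ τ`. [folklore] -/
theorem stub_ergodicH2SmoothingTools : (∀ {ν : ℝ} {F : (UnitAddTorus (Fin 3)) → (EuclideanSpace ℝ (Fin 3))} {K : Set Hsp} {φ : ℝ → Hsp → Hsp}, IsNSPhase ν F K φ → ∃ E₁ : ℝ, ∀ x ∈ K, ∀ (u : ℝ → (UnitAddTorus (Fin 3)) → (EuclideanSpace ℝ (Fin 3))) (p : ℝ → (UnitAddTorus (Fin 3)) → ℝ), IsClassicalNSSolutionOn (Ici 0) ν (fun _ => F) u p → (∀ t : ℝ, 0 ≤ t → rep (φ t x) =ᵐ[volume] u t) → ∀ t : ℝ, 0 ≤ t → gradNormSq (u t) ≤ E₁) ∧ (∀ {ν : ℝ} {F : (UnitAddTorus (Fin 3)) → (EuclideanSpace ℝ (Fin 3))} {K : Set Hsp} {φ : ℝ → Hsp → Hsp}, 0 < ν → IsNSPhase ν F K φ → ∀ {τ : ℝ}, 0 < τ → ∃ C : ℝ, ∀ x ∈ K, ∀ (u : ℝ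 → (UnitAddTorus (Fin 3)) → (EuclideanSpace ℝ (Fin 3))) (p : ℝ → (UnitAddTorus (Fin 3)) → ℝ), IsClassicalNSSolutionOn (Ici 0) ν (fun _ => F) u p → (∀ t : ℝ, 0 ≤ t → rep (φ t x) =ᵐ[volume] u t) → ∀ t : ℝ, τ ≤ t → ∫ y, ‖laplacian (u t) y‖ ^ 2 ≤ C) ∧ (∀ {ν : ℝ} {F : (UnitAddTorus (Fin 3)) → (EuclideanSpace ℝ (Fin 3))} {K : Set Hsp} {φ : ℝ → Hsp → Hsp}, 0 < ν → IsNSPhase ν F K φ → ∀ {τ : ℝ}, 0 < τ → ∃ M : ℝ, ∀ x ∈ K, ∀ (u : ℝ → (UnitAddTorus (Fin 3)) → (EuclideanSpace ℝ (Fin 3))) (p : ℝ → (UnitAddTorus (Fin 3)) → ℝ), IsClassicalNSSolutionOn (Ici 0) ν (fun _ => F) u p → (∀ t : ℝ, 0 ≤ t → rep (φ t x) =ᵐ[volume] u t) → ∀ t : ℝ, τ ≤ t → ∀ y, ‖u t y‖ ≤ M) ∧ (∀ {ν : ℝ} {F : (UnitAddTorus (Fin 3)) → (EuclideanSpace ℝ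 (Fin 3))} {K : Set Hsp} {φ : ℝ → Hsp → Hsp}, 0 < ν → IsNSPhase ν F K φ → ∀ {τ : ℝ}, 0 < τ → ∃ W : ℝ, ∀ x ∈ K, ∀ (u : ℝ → (UnitAddTorus (Fin 3)) → (EuclideanSpace ℝ (Fin 3))) (p : ℝ → (UnitAddTorus (Fin 3)) → ℝ), IsClassicalNSSolutionOn (Ici 0) ν (fun _ => F) u p → (∀ t : ℝ, 0 ≤ t → rep (φ t x) =ᵐ[volume] u t) → ∀ t : ℝ, τ ≤ t → ∫ y, ‖Torus.timeDerivWithin (Ici 0) u t y‖ ^ 2 ≤ W) :=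
  ⟨fun hK => hK.exists_forall_gradNormSq_le, fun hν hK _ hτ => IsNSPhase.exists_forall_integral_norm_laplacian_sq_le hν hK hτ,
    fun hν hK _ hτ => IsNSPhase.exists_forall_norm_le hν hK hτ,
    fun hν hK _ hτ => IsNSPhase.exists_forall_integral_norm_timeDerivWithin_sq_le hν hK hτ⟩

end Summit.AnomalousDissipation.AnomalousDissipation.Theorems.DenseLoudDesignerForces.Ergodic

end
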